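import Summits.AtomisticToContinuum.Crystallization.Theorems.FreeSplittingCertificatesStrictSplittingRuleP1CellRadOdd

/-!
# `StrictSplittingRule` (stmt-AtomisticToContinuum-12560): the CIRCUMRADIUS TABLE of the honeycomb cells, all cells: `exists_p1CellCenter` (P1 interpolant object, part 32c)

Route `FreeSplittingCertificates`, crux r3 `StrictSplittingRule` (H12⋆ = `stub_coreJointCoercive`), unit b2b-freesplit-B gen 24.
VALUE = the geometric input `hρ` of the circumradius form of the demand-side defect (part 31, `vertex_quadrature_excess_rad_p1RealCell` /
`tsum_p1SiteBare_le_rad`): for every real cell `T = (n, π)` of the hcp tet–oct honeycomb (either parity) an explicit centre `y_n + c₀(parity, π)` with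
ALL FOUR vertices at squared distance exactly the squared circumradius — corner tetrahedra (`π = 0, 1`): circumcentre on the axis,
`ρ_tet a h = a²/3 + z²`, `z = (h² − a²/3)/(2h)` (`= 3a²/8` at the ideal ratio); octahedron quarters (`π = 2…5`): the antiprism centre,
`ρ_oct a h = a²/3 + h²/4` (`= a²/2` at the ideal ratio; all six octahedron vertices are equidistant from it for EVERY `h`).  Main statement
**`exists_p1CellCenter`**: `∀ T, ∃ c, ∀ m, fpSq (y_m − c) ≤ (if π ≤ 1 then ρ_tet else ρ_oct)`.  Generated from the vertex tables `p1VertOff` by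
`code/partB/gen24-lean/gen/gen_rad_lean.py` (sympy-verified identities `fpSq(d − c₀) − ρ = α(√3² − 3) + β(2hz − h² + a²/3)`).
NOT a proof of H12⋆, NOT summit progress.  [folklore]
-/

noncomputable section

open Set Function
open scoped BigOperators

namespace Summit.AtomisticToContinuum.Crystallization.Theorems.StrictSplittingRuleBirth

open Literature.MathematicalPhysics.StatisticalMechanics
open Summit.AtomisticToContinuum.Crystallization.Theorems.PalmUnimodularRigidity.LayeredLawsSelectHcp

/-- **THE CIRCUMRADIUS TABLE**: every real cell `T = (n, π)` has a centre within `|·|² ≤ ρ_T` of all four vertices,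
`ρ_T = a²/3 + ((h² − a²/3)/(2h))²` for the corner tetrahedra (`π ≤ 1`) and `a²/3 + h²/4` for the octahedron quarters — the hypothesis `hρ` of
`tsum_p1SiteBare_le_rad`.  NOT a proof of H12⋆, NOT summit progress. -/
theorem exists_p1CellCenter (a h : ℝ) (hh : h ≠ 0) (i : (ℤ × ℤ × ℤ) × Fin 6) :
    ∃ c : Fin 3 → ℝ, ∀ m : Fin 4, fpSq (fun k => hcpSite a h (i.1 + p1VertOff (p1Par i.1) i.2 m) k - c k) ≤
      (if i.2 ≤ 1 then a ^ 2 / 3 + ((h ^ 2 - a ^ 2 / 3) / (2 * h)) ^ 2 else a ^ 2 / 3 + h ^ 2 / 4) := by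
  obtain ⟨n, π⟩ := i
  dsimp only
  by_cases hn : Even n.1
  · have hp : p1Par n = true := by simp [p1Par, hn]
    simp only [hp]
    fin_cases π

    · exact ⟨_, by rw [if_pos (by decide)]; exact p1CellCenter_even_0 a h hh n hn⟩

    · exact ⟨_, by rw [if_pos (by decide)]; exact p1CellCenter_even_1 a h hh n hn⟩

    · exact ⟨_, by rw [if_neg (by decide)]; exact p1CellCenter_even_2 a h hh n hn⟩

    · exact ⟨_, by rw [if_neg (by decide)]; exact p1CellCenter_even_3 a h hh n hn⟩

    · exact ⟨_, by rw [if_neg (by decide)]; exact p1CellCenter_even_4 a h hh n hn⟩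

    · exact ⟨_, by rw [if_neg (by decide)]; exact p1CellCenter_even_5 a h hh n hn⟩

  · have hn' : Odd n.1 := Int.not_even_iff_odd.1 hn
    have hp : p1Par n = false := by simp [p1Par, hn]
    simp only [hp]
    fin_cases π

    · exact ⟨_, by rw [if_pos (by decide)]; exact p1CellCenter_odd_0 a h hh n hn'⟩

    · exact ⟨_, by rw [if_pos (by decide)]; exact p1CellCenter_odd_1 a h hh n hn'⟩

    · exact ⟨_, by rw [if_neg (by decide)]; exact p1CellCenter_odd_2 a h hh n hn'⟩

    · exact ⟨_, by rw [if_neg (by decide)]; exact p1CellCenter_odd_3 a h hh n hn'⟩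

    · exact ⟨_, by rw [if_neg (by decide)]; exact p1CellCenter_odd_4 a h hh n hn'⟩

    · exact ⟨_, by rw [if_neg (by decide)]; exact p1CellCenter_odd_5 a h hh n hn'⟩


end Summit.AtomisticToContinuum.Crystallization.Theorems.StrictSplittingRuleBirth
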